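import Literature.IUT.LogThetaLattice.GlobalLGPFrobenioidsModFrakRlfModel
import Literature.IUT.LogThetaLattice.GlobalLGPFrobenioidsRealifiedFrobenioid
import Literature.AlgebraicGeometry.Frobenioids.RealificationDataCanonical
import HarnessLib

/-!
# [FrdI] Prop. 5.3 at the model of [IUTchIII] Prop. 3.7 (ii): THE realification functor `Φ(∗)^rlf` of the
# divisor monoid of `(†𝓕⊛_𝔪𝔬𝔡)_α` IS the divisor monoid `Φ^ℝ(∗)` of `(†𝓕⊛ℝ_𝔪𝔬𝔡)_α`, as functors on the one-morphism
# base (abc-iut cell, layer L6; sub-row «J1-rlf-bridge», functor-level packaging; written by abc-iut-w4-d015)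

S. Mochizuki, *The geometry of Frobenioids I*, Prop. 5.3 p. 103 ("the realification `C^rlf` … the model Frobenioid
associated to the divisor monoid `Φ^rlf` [i.e. the realification of Definition 2.4, (i)] and the rational function
monoid `ℝ · Φ^birat`") [cite: MochizukiFrdI2008, Prop. 5.3 p.103]; S. Mochizuki, *Inter-universal Teichmüller theory
III*, Prop. 3.7 (ii) p. 110 l. 48–49 ("Write `(†𝓕⊛ℝ_𝔪𝔬𝔡)_α` for the realification") [claim: Mochizuki2012, status:
disputed].

WHAT. Layer L1's canonical realification data (abc-iut-L1-d2 `RealificationData.canonical Φ hΦ`, with `rlf :=` the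
realification FUNCTOR `rlfFunctor Φ hΦ` of abc-iut-L2-d2) instantiated at the divisor monoid `Φmod` of
abc-iut-w4-d005's INTEGRAL `(†𝓕⊛_𝔪𝔬𝔡)_α` with `hΦ := Prop37.isPerfFactorial_Phimod` (`GlobalLGPFrobenioidsModFrakPerfFactorial`),
and its identification with abc-iut-w5-d153's `Prop37.FrakRlfCat.PhiRlf F = Φmod (ModelPlaces F) (fun _ ↦ ℝ) nonnegModel`
(the divisor monoid of THE [FrdI] Thm. 5.2 model of `(†𝓕⊛ℝ_𝔪𝔬𝔡)_α`, `GlobalLGPFrobenioidsRealifiedFrobenioid`):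
* `Prop37.canonicalRlfData` — `RealificationData.canonical (Φmod (Places F) (Gamma F) (nonneg F)) (isPerfFactorial_Phimod F)`;
* **`Prop37.rlfFunctorIsoPhiRlf : (canonicalRlfData F).rlf ≅ FrakRlfCat.PhiRlf F`** — the natural isomorphism with
  components `Prop37.rlfEquivModel` (the one-morphism base has only identity arrows);
* `rlfFunctorIsoPhiRlf_hom_app_toRlf` — on `Φ(∗) → Φ(∗)^pf → Φ(∗)^rlf` (`(canonicalRlfData F).toRlf`) the
  isomorphism is abc-iut-w4-d005's realification on objects.
This is the «identification of THE canonical `(RealificationData.canonical Φmod_int _).rlf` with `Φmod` over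
`(ModelPlaces F, ℝ)` along `realifyObjHom`» named as the residual of J1 (abc-iut-w5-d153, 02:51Z); with it,
abc-iut-w5-d153's `FrakRlfCat.toModel` / layer L1's `RealificationData.RlfModelOf` comparison (J1 in full, part D) has
all its inputs in the tree. Nothing here asserts a disputed claim or takes a side on [IUTchIII] Cor. 3.12; typed ≠
discharged; instantiated ≠ endorsed.
-/

noncomputable section

namespace Literature.IUT.LogThetaLattice

namespace Prop37

open CategoryTheory Opposite NumberField GlobalFrobenioidModels Literature.AlgebraicGeometry.Frobenioids
  Literature.AnabelianGeometry.EtaleTheta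

variable (F : Type) [Field F] [NumberField F]

/-- **THE canonical realification data of the divisor monoid of `(†𝓕⊛_𝔪𝔬𝔡)_α`** (integral datum): layer L1's
`RealificationData.canonical` at `Φ := Φmod (Places F) (Gamma F) (nonneg F)` and `hΦ := isPerfFactorial_Phimod F`.
[cite: MochizukiFrdI2008, Prop. 5.3 p.103] -/
def canonicalRlfData : RealificationData (Φmod (Places F) (Gamma F) (nonneg F)) :=
  RealificationData.canonical (Φmod (Places F) (Gamma F) (nonneg F)) (isPerfFactorial_Phimod F)

/-- Its `rlf` is the realification functor `rlfFunctor`. [cite: MochizukiFrdI2008, Prop. 5.3 p.103] -/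
theorem canonicalRlfData_rlf :
    (canonicalRlfData F).rlf = rlfFunctor (Φmod (Places F) (Gamma F) (nonneg F)) (isPerfFactorial_Phimod F) := rfl

/-- On the one-morphism base every arrow of `Baseᵒᵖ` is an identity. [folklore] -/
private theorem base_hom_eq_id {X Y : Base.{0}ᵒᵖ} (f : X ⟶ Y) : ∃ h : X = Y, f = h ▸ 𝟙 X := by
  obtain ⟨⟨⟨⟩⟩⟩ := X
  obtain ⟨⟨⟨⟩⟩⟩ := Y
  exact ⟨rfl, Subsingleton.elim _ _⟩

/-- **`Φ(∗)^rlf ≅ Φ^ℝ(∗)` as functors on the one-morphism base**: THE realification functor of the INTEGRAL divisor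
monoid of `(†𝓕⊛_𝔪𝔬𝔡)_α` is naturally isomorphic to the REAL divisor monoid functor `FrakRlfCat.PhiRlf F` of
`(†𝓕⊛ℝ_𝔪𝔬𝔡)_α`, with components `rlfEquivModel` ([FrdI] Thm. 6.4 (i) at the model). [cite: MochizukiFrdI2008, Prop. 5.3 p.103] -/
def rlfFunctorIsoPhiRlf : (canonicalRlfData F).rlf ≅ FrakRlfCat.PhiRlf F :=
  NatIso.ofComponents (fun _ => (rlfEquivModel F).toCommMonCatIso) (by
    intro X Y f
    obtain ⟨rfl, rfl⟩ := base_hom_eq_id f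
    simp)

/-- The components of `rlfFunctorIsoPhiRlf` are `rlfEquivModel`. [cite: MochizukiFrdI2008, Prop. 5.3 p.103] -/
@[simp] theorem rlfFunctorIsoPhiRlf_hom_app_hom_apply (X : Base.{0}ᵒᵖ) (x : (isPerfFactorial_effDiv F).Rlf) :
    ((rlfFunctorIsoPhiRlf F).hom.app X).hom x = rlfEquivModel F x := rfl

/-- The inverse components are `rlfEquivModel.symm`. [cite: MochizukiFrdI2008, Prop. 5.3 p.103] -/
@[simp] theorem rlfFunctorIsoPhiRlf_inv_app_hom_apply (X : Base.{0}ᵒᵖ) (y : MReal F) :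
    ((rlfFunctorIsoPhiRlf F).inv.app X).hom y = (rlfEquivModel F).symm y := rfl

/-- **Compatibility with `Φ → Φ^rlf`**: composing the canonical data's natural map `Φ(∗) → Φ(∗)^pf → Φ(∗)^rlf`
(`RealificationData.toRlf`) with the isomorphism gives abc-iut-w4-d005's realification on effective families
(`realifyEffMul`). [cite: MochizukiFrdI2008, Prop. 5.3 p.103] -/
theorem rlfFunctorIsoPhiRlf_hom_app_toRlf (X : Base.{0}ᵒᵖ) (D : EffDiv (Places F) (Gamma F) (nonneg F)) :
    ((rlfFunctorIsoPhiRlf F).hom.app X).hom (((canonicalRlfData F).toRlf.app X).hom D) = realifyEffMul F D := by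
  show rlfEquivModel F (((RealificationData.canonical (Φmod (Places F) (Gamma F) (nonneg F))
    (isPerfFactorial_Phimod F)).toRlf.app X).hom D) = _
  rw [RealificationData.canonical_toRlf_app_hom]
  exact rlfEquivModel_iotaRlf F D

end Prop37

end Literature.IUT.LogThetaLattice

end
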